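import Summits.Ventures.PercRepro.ProfileFlatUpsetCorankLeTwo
import Summits.Ventures.PercRepro.ProfileFlatUpsetLineRankFive
import Summits.Ventures.PercRepro.ProfileFlatUpsetLineThree
import Summits.Ventures.PercRepro.ProfileFlatUpsetRankOne

/-!
# PercRepro — (G) AT EVERY PRINCIPAL UP-SET OF EVERY RANK-5 MATROID ON 8 POINTS
(p10, gen 20; `proofs/P10-AVFULL.md` §28(i))

THE ASSEMBLY over the rank `s` of the flat `F₀` of a rank-`5` matroid on `8 = 2r − 2` points: `s = 0` — no separated
set (`F₀ ⊆ cl ∅ ⊆ cl (E ∖ Z)`; `sepSets_principal_eq_empty_of_rk_zero`); `s = 1` — the rank-one module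
(`sum_sepSets_principal_nonneg_of_rk_one`); `s = 2` with two points — the rank-5 double counting
(`sum_sepSets_principal_line_rank_five_nonneg`), with three points — the swap double counting
(`sum_sepSets_principal_nonneg_of_line_three`), with four or more points — no separated set
(`sum_sepSets_principal_nonneg_of_four_le_card`); `s ≥ 3` — the corank-`≤ 2` capstone of gen 19
(`sum_sepSets_principal_nonneg_of_corank_le_two`).  THEOREM `sum_sepSets_principal_nonneg_rank_five_eight`: the
row `n = 8`, `r = 5` of (G) at principal up-sets is CLOSED — in pointed language, the coloop limit (C1′) for every
point placed freely on any flat of any rank-`5` matroid on `8` points (`9` points, nullity `4` after the extension).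
Census (own code, gen 20, census1.py): `0` violations on all 19,960 instances `(M, F₀)` with `1 ≤ rk F₀ ≤ 3` and a
negative set at `n = 8`, `r = 5` (the flats of corank `≤ 2` are the capstone's).
Nothing here asserts (G) beyond this row.
-/

open scoped Matroid

namespace PercRepro.Cogirth

open Finset ThmH Skew

variable {α : Type} [DecidableEq α] {M : Matroid α} [M.Finite]

/-- A flat of rank `0` is spanned by every set, so nothing is separated by its principal up-set. -/
theorem sepSets_principal_eq_empty_of_rk_zero {F₀ : Finset α} (hF : IsFlatF M F₀) (hrF : rk M F₀ = 0) :
    sepSets M (principalUp M F₀) = ∅ := by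
  rw [eq_empty_iff_forall_notMem]
  intro Z hZ
  obtain ⟨_, hout⟩ := subset_clF_of_mem_sepSets_principal hZ
  apply hout
  exact (subset_clF_of_rk_le hF.1 (empty_subset F₀) (by rw [hrF]; exact Nat.zero_le _)).trans
    (clF_mono_fu (empty_subset _))

/-- **(G) AT EVERY PRINCIPAL UP-SET OF EVERY RANK-5 MATROID ON 8 POINTS.** -/
theorem sum_sepSets_principal_nonneg_rank_five_eight {F₀ : Finset α} (hF : IsFlatF M F₀) (hr : rk M (gr M) = 5)
    (hN : (gr M).card = 8) :
    0 ≤ ∑ Z ∈ sepSets M (principalUp M F₀), (2 * (Z.card : ℤ) - (gr M).card - 1) := by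
  have hN' : (gr M).card + 2 = 2 * rk M (gr M) := by omega
  have hle : rk M F₀ ≤ 5 := by have := rk_mono_fu (M := M) hF.1; omega
  -- the rank of `F₀`
  rcases Nat.lt_or_ge (rk M F₀) 3 with hlt | hge
  · have hcases : rk M F₀ = 0 ∨ rk M F₀ = 1 ∨ rk M F₀ = 2 := by omega
    rcases hcases with h0 | h1 | h2
    · rw [sepSets_principal_eq_empty_of_rk_zero hF h0, sum_empty]
    · exact sum_sepSets_principal_nonneg_of_rk_one hF hN' h1
    · -- the number of points of the line
      have hc2 : 2 ≤ F₀.card := by have := rk_le_card (M := M) F₀; omega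
      rcases Nat.lt_or_ge F₀.card 4 with hlt4 | hge4
      · rcases (show F₀.card = 2 ∨ F₀.card = 3 by omega) with hc | hc
        · obtain ⟨e, f, hef, hF₀⟩ := card_eq_two.1 hc
          exact sum_sepSets_principal_line_rank_five_nonneg hF hef hF₀ h2 hr hN
        · exact sum_sepSets_principal_nonneg_of_line_three hF hN' h2 hc
      · exact sum_sepSets_principal_nonneg_of_four_le_card hF h2 hge4
  · exact sum_sepSets_principal_nonneg_of_corank_le_two hF (by omega)

end PercRepro.Cogirth
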